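import Mathlib.RingTheory.MvPolynomial.Homogeneous
import Mathlib.RingTheory.GradedAlgebra.Homogeneous.Ideal
import Mathlib.Algebra.Polynomial.Roots
import HarnessLib

/-!
# Ideals of `K[x]` stable under the scalings `x ↦ c x` are homogeneous (`K` infinite)

Topic: `Literature/RingTheory/GradedAlgebra`. The torus `𝔾_m` acts on the polynomial ring
`K[x_t : t ∈ σ]` by `σ_c : x_t ↦ c x_t`; a form of degree `e` is an eigenvector with eigenvalue
`cᵉ` (`scale_of_isHomogeneous`), so the homogeneous components of `F` are recovered from the
`σ_c F` by a Vandermonde argument as soon as `K` has enough units. Consequently **an ideal of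
`K[x]` over an infinite field `K` which is stable under all `σ_c`, `c ≠ 0`, is homogeneous**
(`ideal_isHomogeneous_of_forall_scale_mem`) — the elementary case of "a `𝔾_m`-stable
subspace is graded" (folklore; cf. Bruns–Herzog, *Cohen–Macaulay rings*, §1.5). It is used to see that canonically defined ideals attached to a
homogeneous ideal (annihilators of `Ext` modules of `K[x]/I`) are homogeneous, in Kawasaki's
selection of homogeneous parameters (Kawasaki 2000, Lemma 5.3).

Proof: induction on a degree bound `N`; for `F ∈ I` of total degree `≤ N` the element
`σ_c F − c^N F ∈ I` has components `(cᵉ − c^N) F_e`, `e < N`, of total degree `< N`, and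
`cᵉ ≠ c^N` for a suitable `c` (finitely many roots of unity of order `≤ N` to avoid).

Everything is proved; no named facts. All [folklore].
-/

noncomputable section

open MvPolynomial Finsupp

namespace Literature.RingTheory.GradedAlgebra

variable {σ : Type*} {K : Type*} [CommRing K]

/-- **The scaling `σ_c : x_t ↦ c x_t`** of the polynomial ring. [folklore] -/
def scale (c : K) : MvPolynomial σ K →ₐ[K] MvPolynomial σ K :=
  MvPolynomial.aeval fun t => C c * X t

/-- `σ_c x_t = c x_t`. [folklore] -/
theorem scale_X (c : K) (t : σ) : scale c (X t : MvPolynomial σ K) = C c * X t := by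
  simp [scale]

/-- `σ_c` on a monomial: `x^d ↦ c^{|d|} x^d`. [folklore] -/
theorem scale_monomial (c : K) (d : σ →₀ ℕ) (r : K) :
    scale c (monomial d r) = C (c ^ d.degree) * monomial d r := by
  rw [scale, aeval_monomial, monomial_eq]
  have h1 : (d.prod fun i k => (C c * X i : MvPolynomial σ K) ^ k) =
      C (c ^ d.degree) * d.prod fun i k => (X i : MvPolynomial σ K) ^ k := by
    simp only [mul_pow, Finsupp.prod_mul]
    congr 1
    rw [Finsupp.prod, Finset.prod_pow_eq_pow_sum, map_pow]
    rfl
  rw [h1, MvPolynomial.algebraMap_eq]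
  ring

/-- **Forms are eigenvectors of the scalings**: `σ_c G = cᵉ G` for `G` homogeneous of degree `e`.
[folklore] -/
theorem scale_of_isHomogeneous (c : K) {G : MvPolynomial σ K} {e : ℕ} (hG : G.IsHomogeneous e) :
    scale c G = C (c ^ e) * G := by
  have key : ∀ d ∈ G.support,
      scale c (monomial d (coeff d G)) = C (c ^ e) * monomial d (coeff d G) := by
    intro d hd
    rw [scale_monomial]
    congr 2
    have := hG (MvPolynomial.mem_support_iff.mp hd)
    rw [Finsupp.weight_apply] at this
    rw [← this, Finsupp.degree]
    simp [Finsupp.sum]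
  calc scale c G = scale c (∑ d ∈ G.support, monomial d (coeff d G)) := by rw [← G.as_sum]
    _ = ∑ d ∈ G.support, scale c (monomial d (coeff d G)) := map_sum _ _ _
    _ = ∑ d ∈ G.support, C (c ^ e) * monomial d (coeff d G) := Finset.sum_congr rfl key
    _ = C (c ^ e) * ∑ d ∈ G.support, monomial d (coeff d G) := Finset.mul_sum _ _ _ |>.symm
    _ = C (c ^ e) * G := by rw [← G.as_sum]

/-- The homogeneous components of `σ_c F`: `(σ_c F)_n = cⁿ F_n`. [folklore] -/
theorem homogeneousComponent_scale (c : K) (F : MvPolynomial σ K) (n : ℕ) :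
    homogeneousComponent n (scale c F) = C (c ^ n) * homogeneousComponent n F := by
  conv_lhs => rw [← sum_homogeneousComponent F]
  rw [map_sum, map_sum]
  have : ∀ i, homogeneousComponent n (scale c (homogeneousComponent i F)) =
      if n = i then C (c ^ n) * homogeneousComponent n F else 0 := by
    intro i
    rw [scale_of_isHomogeneous c (homogeneousComponent_isHomogeneous i F),
      homogeneousComponent_C_mul, homogeneousComponent_of_mem (homogeneousComponent_mem i F)]
    split_ifs with h
    · subst h; rfl
    · rw [mul_zero]
  simp only [this, Finset.sum_ite_eq, Finset.mem_range]
  split_ifs with h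
  · rfl
  · rw [homogeneousComponent_eq_zero _ _ (by omega), mul_zero]

/-- If all components of degree `≥ N` vanish then the total degree is `< N` (or the polynomial is
`0`). [folklore] -/
theorem totalDegree_lt_of_homogeneousComponent_eq_zero {F : MvPolynomial σ K} {N : ℕ}
    (h : ∀ n, N ≤ n → homogeneousComponent n F = 0) (hF : F ≠ 0) : F.totalDegree < N := by
  by_contra hlt
  push Not at hlt
  -- a monomial of top degree survives in the component of degree `totalDegree F`
  obtain ⟨d, hd, hdeg⟩ : ∃ d ∈ F.support, (d.sum fun _ e => e) = F.totalDegree := by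
    have hne : F.support.Nonempty := support_nonempty.mpr hF
    obtain ⟨d, hd, hmax⟩ := Finset.exists_max_image F.support (fun s => s.sum fun _ e => e) hne
    exact ⟨d, hd, le_antisymm (le_totalDegree hd) (Finset.sup_le fun s hs => hmax s hs)⟩
  have hcomp := h F.totalDegree hlt
  have : coeff d (homogeneousComponent F.totalDegree F) = coeff d F := by
    rw [coeff_homogeneousComponent, if_pos]
    rw [Finsupp.degree]
    simpa [Finsupp.sum] using hdeg
  rw [hcomp, coeff_zero] at this
  exact (MvPolynomial.mem_support_iff.mp hd) this.symm

section Field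

variable {K : Type*} [Field K]

/-- Over an infinite field there are nonzero scalars which are not roots of unity of any order
`≤ N`. [folklore] -/
theorem exists_ne_zero_forall_pow_ne_one [Infinite K] (N : ℕ) :
    ∃ c : K, c ≠ 0 ∧ ∀ m, 1 ≤ m → m ≤ N → c ^ m ≠ 1 := by
  classical
  let B : Finset K := {0} ∪ (Finset.range (N + 1)).biUnion fun m => Polynomial.nthRootsFinset m (1 : K)
  obtain ⟨c, hc⟩ := Infinite.exists_notMem_finset B
  refine ⟨c, fun h0 => hc ?_, fun m hm hmN hcm => hc ?_⟩
  · simp [B, h0]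
  · simp only [B, Finset.mem_union, Finset.mem_singleton, Finset.mem_biUnion, Finset.mem_range]
    exact Or.inr ⟨m, by omega, (Polynomial.mem_nthRootsFinset hm 1).mpr hcm⟩

/-- **Scaling-stable ideals are homogeneous** (`K` an infinite field): if `σ_c F ∈ I` for all
`F ∈ I` and all `c ≠ 0`, then every homogeneous component of every `F ∈ I` lies in `I`.
[folklore] -/
theorem homogeneousComponent_mem_of_forall_scale_mem [Infinite K] {I : Ideal (MvPolynomial σ K)}
    (h : ∀ c : K, c ≠ 0 → ∀ F ∈ I, scale c F ∈ I) :
    ∀ (N : ℕ) (F : MvPolynomial σ K), F ∈ I → F.totalDegree ≤ N →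
      ∀ n, homogeneousComponent n F ∈ I := by
  intro N
  induction N with
  | zero =>
    intro F hF hdeg n
    obtain ⟨r, rfl⟩ : ∃ r, F = C r := ⟨_, totalDegree_eq_zero_iff_eq_C.mp (Nat.le_zero.mp hdeg)⟩
    rw [homogeneousComponent_of_mem (isHomogeneous_C σ r)]
    split_ifs
    · exact hF
    · exact I.zero_mem
  | succ N ih =>
    intro F hF hdeg n
    obtain ⟨c, hc0, hc⟩ := exists_ne_zero_forall_pow_ne_one (K := K) (N + 1)
    -- `G = σ_c F - c^{N+1} F ∈ I` has total degree `≤ N`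
    set G := scale c F - C (c ^ (N + 1)) * F with hG
    have hGI : G ∈ I := I.sub_mem (h c hc0 F hF) (I.mul_mem_left _ hF)
    have hGn : ∀ m, homogeneousComponent m G = C (c ^ m - c ^ (N + 1)) * homogeneousComponent m F := by
      intro m
      rw [hG, map_sub, homogeneousComponent_scale, homogeneousComponent_C_mul, map_sub, sub_mul]
    have hGdeg : G.totalDegree ≤ N := by
      by_cases hG0 : G = 0
      · rw [hG0, totalDegree_zero]; exact Nat.zero_le _
      refine Nat.lt_succ_iff.mp (totalDegree_lt_of_homogeneousComponent_eq_zero (fun m hm => ?_) hG0)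
      rw [hGn]
      rcases eq_or_lt_of_le hm with rfl | hlt
      · rw [sub_self, map_zero, zero_mul]
      · rw [homogeneousComponent_eq_zero _ _ (by omega), mul_zero]
    -- components of degree `< N + 1`
    have hlow : ∀ m, m < N + 1 → homogeneousComponent m F ∈ I := by
      intro m hm
      have hunit : c ^ m - c ^ (N + 1) ≠ 0 := by
        intro h0
        have h1 : c ^ m * (1 - c ^ (N + 1 - m)) = 0 := by
          rw [mul_sub, mul_one, ← pow_add, Nat.add_sub_cancel' hm.le, h0]
        rcases mul_eq_zero.mp h1 with h2 | h2
        · exact pow_ne_zero m hc0 h2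
        · exact hc (N + 1 - m) (by omega) (by omega) (sub_eq_zero.mp h2).symm
      have hm' := ih G hGI hGdeg m
      rw [hGn] at hm'
      have : homogeneousComponent m F =
          C (c ^ m - c ^ (N + 1))⁻¹ * (C (c ^ m - c ^ (N + 1)) * homogeneousComponent m F) := by
        rw [← mul_assoc, ← map_mul, inv_mul_cancel₀ hunit, map_one, one_mul]
      rw [this]
      exact I.mul_mem_left _ hm'
    -- the component of degree `N + 1`, and above
    rcases lt_trichotomy n (N + 1) with hn | rfl | hn
    · exact hlow n hn
    · have hsum := sum_homogeneousComponent F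
      by_cases htop : F.totalDegree < N + 1
      · rw [homogeneousComponent_eq_zero _ _ htop]; exact I.zero_mem
      have hdeg' : F.totalDegree = N + 1 := le_antisymm hdeg (not_lt.mp htop)
      rw [hdeg', Finset.sum_range_succ] at hsum
      have : homogeneousComponent (N + 1) F =
          F - ∑ i ∈ Finset.range (N + 1), homogeneousComponent i F := by
        rw [eq_sub_iff_add_eq, add_comm, hsum]
      rw [this]
      exact I.sub_mem hF (I.sum_mem fun i hi => hlow i (Finset.mem_range.mp hi))
    · rw [homogeneousComponent_eq_zero _ _ (by omega)]; exact I.zero_mem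

attribute [local instance] MvPolynomial.gradedAlgebra

/-- **An ideal of `K[x]`, `K` an infinite field, stable under the scalings `x ↦ c x` (`c ≠ 0`) is
homogeneous.** [folklore] -/
theorem ideal_isHomogeneous_of_forall_scale_mem [Infinite K] {I : Ideal (MvPolynomial σ K)}
    (h : ∀ c : K, c ≠ 0 → ∀ F ∈ I, scale c F ∈ I) :
    I.IsHomogeneous (homogeneousSubmodule σ K) := by
  intro n F hF
  rw [← DirectSum.Decomposition.decompose'_eq]
  change (MvPolynomial.decomposition.decompose' F n : MvPolynomial σ K) ∈ I
  rw [MvPolynomial.decomposition.decompose'_apply]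
  exact homogeneousComponent_mem_of_forall_scale_mem h F.totalDegree F hF le_rfl n

end Field

end Literature.RingTheory.GradedAlgebra

end
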